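import Literature.RingTheory.HilbertSamuel.HypersurfaceSection
import Literature.RingTheory.HilbertSamuel.TangentConeBaseChange
import Literature.RingTheory.HilbertSamuel.TangentConeChangeOfGenerators
import HarnessLib

/-!
# [OURS · L1 W4.2] The `e = 1` door OUTSIDE the hypersurface cell, step 2 — **LOCAL ALGEBRA OF A SUPERFICIAL EXCEPTIONAL PARAMETER**:
# the EQUALITY case `H^{(1)}(A/t) = H^{(0)}(A)` of the hypersurface-section inequality
# (crux `SigmaMaxModifications` stmt-ResolutionOfSingularities-18506 / conjunct stmt-…-19249, line `w_ladder_rows` v8.5, row `stub_twoClaims` (β);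
# `--supports 19249`, helper)

Stub worker res-L1-w42-stub-3 (gen 6). Sorry-free PROOF file, no definition, no named fact. OURS bookkeeping for the W4.2 crux chain
(cell res-hironaka); NOT a statement of [Hironaka2017] nor of [CossartJannsenSaito2020]. AI-written; AI review is weaker than expert review.

For a Noetherian local ring `(A, 𝔪, k)` and `t ∈ 𝔪` the tree proves `H^{(0)}_A ≤ H^{(1)}_{A/tA}` (`hilbertFun_le_hilbertSamuelFun_one_quotient`,
CJS (3.14) first inequality). This file treats EQUALITY (Singh's «`t` superficial and regular on `gr_𝔪(A)`»):

* `mem_pow_of_mul_mem_pow_succ_of_hilbertFun_eq` — if `H^{(1)}_{A/tA} = H^{(0)}_A` then `t·a ∈ 𝔪^{s+1} ⇒ a ∈ 𝔪^s` for all `s`, i.e. the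
  symbol of `t` is a non-zero-divisor of degree `1` on `gr_𝔪(A)` (lengths in `0 → 𝔪^s/… → A/𝔪^s →·t A/𝔪^{s+1} → A/(𝔪^{s+1} + tA) → 0`);
* `tangentConeIdeal_quotient_le_map_sup_span_X` — and then the ideal of initial forms of `A/tA` (w.r.t. the images of generators `y` of `𝔪`
  with `y_j = t`) is `J_A(y)·k'[X] + (X_j)`: `gr_𝔪(A/tA) = gr_𝔪(A)/(T)` (the inclusion `⊇` is the tree's `map_tangentConeIdeal_le`).

[OURS · L1 W4.2; AI-written] [cite: CossartJannsenSaito2020, §2.2 (p. 27), proof of Thm. 3.10 (3.14)] [cite: HerrmannIkedaOrbanz1988, Thm. (22.24)]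
-/

set_option linter.dupNamespace false

noncomputable section

open IsLocalRing MvPolynomial Finset
open Literature.RingTheory.MvPolynomial Literature.RingTheory.HilbertSamuel

namespace Summit.ResolutionOfSingularities.ResolutionOfSingularities.Theorems.SigmaMaxModificationsCorridor3.E1Free

universe u

/-! ## The equality case of the hypersurface-section inequality -/

section Superficial

variable {A : Type u} [CommRing A] [IsLocalRing A] [IsNoetherianRing A]

/-- **EQUALITY in `H^{(0)}_A ≤ H^{(1)}_{A/tA}` forces `(𝔪^{s+1} : t) = 𝔪^s`**: the multiplication `A/𝔪^s → A/𝔪^{s+1}`, `a ↦ ta`, has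
cokernel `A/(𝔪^{s+1} + tA)` of length `H^{(1)}_{A/tA}(s) = H^{(0)}_A(s) = ℓ(A/𝔪^{s+1}) − ℓ(A/𝔪^s)`, hence trivial kernel.
[cite: CossartJannsenSaito2020, proof of Thm. 3.10, (3.14)] [cite: HerrmannIkedaOrbanz1988, Thm. (22.24)] -/
theorem mem_pow_of_mul_mem_pow_succ_of_hilbertFun_eq {t : A} [IsLocalRing (A ⧸ Ideal.span {t})]
    (h : ∀ s, hilbertSamuelFun (A ⧸ Ideal.span {t}) 1 s = hilbertFun A s) (s : ℕ) {a : A}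
    (ha : t * a ∈ maximalIdeal A ^ (s + 1)) : a ∈ maximalIdeal A ^ s := by
  set P : Ideal A := maximalIdeal A ^ (s + 1) with hP
  set Q : Ideal A := maximalIdeal A ^ s with hQ
  -- `t` is not a unit: `A ⧸ (t)` is a (nontrivial) local ring
  have ht : t ∈ maximalIdeal A := by
    refine (IsLocalRing.mem_maximalIdeal t).mpr fun hu => ?_
    have h1 : (1 : A ⧸ Ideal.span {t}) = 0 := by
      rw [← map_one (Ideal.Quotient.mk (Ideal.span {t})), Ideal.Quotient.eq_zero_iff_mem,
        Ideal.span_singleton_eq_top.mpr hu]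
      exact Submodule.mem_top
    exact one_ne_zero h1
  have hQP : ∀ b ∈ Q, t * b ∈ P := fun b hb => by
    rw [hP, pow_succ']
    exact Ideal.mul_mem_mul ht hb
  -- the multiplication by `t` and the projection
  let φ : (A ⧸ Q) →ₗ[A] (A ⧸ P) := Q.liftQ (P.mkQ ∘ₗ LinearMap.mulLeft A t) (by
    intro b hb
    rw [LinearMap.mem_ker, LinearMap.comp_apply, LinearMap.mulLeft_apply, Submodule.mkQ_apply,
      Submodule.Quotient.mk_eq_zero]
    exact hQP b hb)
  let ψ : (A ⧸ P) →ₗ[A] (A ⧸ (P ⊔ Ideal.span {t})) := Submodule.factor (le_sup_left : P ≤ P ⊔ Ideal.span {t})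
  have hψ : Function.Surjective ψ := Submodule.factor_surjective _
  have hexact : Function.Exact (LinearMap.range φ).subtype ψ := by
    intro y
    constructor
    · intro hy
      obtain ⟨b, rfl⟩ := Submodule.mkQ_surjective P y
      rw [Submodule.factor_mk, Submodule.mkQ_apply, Submodule.Quotient.mk_eq_zero, Submodule.mem_sup] at hy
      obtain ⟨p, hp, w, hw, hpw⟩ := hy
      obtain ⟨c, rfl⟩ := Ideal.mem_span_singleton'.mp hw
      refine ⟨⟨Submodule.mkQ P b, ⟨Submodule.Quotient.mk c, ?_⟩⟩, rfl⟩
      rw [Submodule.liftQ_apply, LinearMap.comp_apply, LinearMap.mulLeft_apply, Submodule.mkQ_apply,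
        Submodule.mkQ_apply, Submodule.Quotient.eq, ← hpw]
      have : t * c - (p + c * t) = -p := by ring
      rw [this]
      exact P.neg_mem hp
    · rintro ⟨⟨y', ⟨z, rfl⟩⟩, rfl⟩
      obtain ⟨c, rfl⟩ := Submodule.mkQ_surjective Q z
      change ψ (φ (Submodule.mkQ Q c)) = 0
      rw [Submodule.mkQ_apply, Submodule.liftQ_apply, LinearMap.comp_apply, LinearMap.mulLeft_apply]
      change Submodule.factor _ (Submodule.mkQ P (t * c)) = 0
      rw [Submodule.factor_mk, Submodule.mkQ_apply, Submodule.Quotient.mk_eq_zero]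
      exact Ideal.mem_sup_right (Ideal.mem_span_singleton'.mpr ⟨c, by ring⟩)
  have hexact' : Function.Exact (LinearMap.ker φ).subtype φ.rangeRestrict := by
    intro z
    constructor
    · intro hz
      exact ⟨⟨z, by simpa [LinearMap.mem_ker] using congrArg Subtype.val hz⟩, rfl⟩
    · rintro ⟨⟨z', hz'⟩, rfl⟩
      exact Subtype.ext (by simpa [LinearMap.mem_ker] using hz')
  have h1 := Module.length_eq_add_of_exact (LinearMap.range φ).subtype ψ (Submodule.subtype_injective _) hψ hexact
  have h2 := Module.length_eq_add_of_exact (LinearMap.ker φ).subtype φ.rangeRestrict (Submodule.subtype_injective _)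
    φ.surjective_rangeRestrict hexact'
  -- the three lengths
  have hlP : Module.length A (A ⧸ P) = ((∑ i ∈ range (s + 1), hilbertFun A i : ℕ) : ℕ∞) :=
    (sum_hilbertFun_eq_length A s).symm
  have hlQ : Module.length A (A ⧸ Q) = ((∑ i ∈ range s, hilbertFun A i : ℕ) : ℕ∞) :=
    (sum_range_hilbertFun_eq_length A s).symm
  have hlC : Module.length A (A ⧸ (P ⊔ Ideal.span {t})) = (hilbertFun A s : ℕ∞) := by
    rw [← h s]
    have hk : RingHom.ker (algebraMap A (A ⧸ Ideal.span {t})) = Ideal.span {t} := by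
      rw [Ideal.Quotient.algebraMap_eq, Ideal.mk_ker]
    have := length_quotient_pow_sup_ker_eq (A := A) (B := A ⧸ Ideal.span {t})
      (by rw [Ideal.Quotient.algebraMap_eq]; exact Ideal.Quotient.mk_surjective) s
    rwa [hk] at this
  -- cancel
  have hrange : Module.length A (LinearMap.range φ) = ((∑ i ∈ range s, hilbertFun A i : ℕ) : ℕ∞) := by
    rw [hlP, hlC, sum_range_succ, Nat.cast_add] at h1
    have hfin : (hilbertFun A s : ℕ∞) ≠ ⊤ := ENat.coe_ne_top _
    exact (ENat.add_left_injective_of_ne_top hfin h1).symm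
  have hker : Module.length A (LinearMap.ker φ) = 0 := by
    rw [hlQ, hrange] at h2
    have hfin : ((∑ i ∈ range s, hilbertFun A i : ℕ) : ℕ∞) ≠ ⊤ := ENat.coe_ne_top _
    have h3 : (0 : ℕ∞) + ((∑ i ∈ range s, hilbertFun A i : ℕ) : ℕ∞) =
        Module.length A (LinearMap.ker φ) + ((∑ i ∈ range s, hilbertFun A i : ℕ) : ℕ∞) := by
      rw [zero_add]; exact h2
    exact (ENat.add_left_injective_of_ne_top hfin h3).symm
  have hkerbot : LinearMap.ker φ = ⊥ := by
    rw [Module.length_eq_zero_iff] at hker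
    exact (Submodule.eq_bot_iff _).mpr fun z hz => congrArg Subtype.val (Subsingleton.elim (⟨z, hz⟩ : LinearMap.ker φ) 0)
  -- conclude
  have hza : φ (Submodule.Quotient.mk a) = 0 := by
    change (Q.liftQ (P.mkQ ∘ₗ LinearMap.mulLeft A t) _) (Submodule.Quotient.mk a) = 0
    rw [Submodule.liftQ_apply, LinearMap.comp_apply, LinearMap.mulLeft_apply, Submodule.mkQ_apply,
      Submodule.Quotient.mk_eq_zero]
    exact ha
  have hmem : (Submodule.Quotient.mk a : A ⧸ Q) ∈ LinearMap.ker φ := hza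
  rw [hkerbot, Submodule.mem_bot, Submodule.Quotient.mk_eq_zero] at hmem
  exact hmem

end Superficial

/-! ## The ideal of initial forms of `A/tA` -/

section Quotient

variable {A : Type u} [CommRing A] [IsLocalRing A] {d : ℕ}

/-- A homogeneous polynomial over a quotient ring lifts to a homogeneous polynomial of the same degree. [folklore] -/
theorem exists_isHomogeneous_map_eq_of_surjective {R S : Type u} [CommRing R] [CommRing S] (f : R →+* S)
    (hf : Function.Surjective f) {σ : Type*} {m : ℕ} (G : MvPolynomial σ S) (hG : G.IsHomogeneous m) :
    ∃ F : MvPolynomial σ R, F.IsHomogeneous m ∧ MvPolynomial.map f F = G := by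
  classical
  choose lift hlift using hf
  refine ⟨∑ u ∈ G.support, monomial u (lift (coeff u G)), ?_, ?_⟩
  · refine IsHomogeneous.sum _ _ _ fun u hu => isHomogeneous_monomial _ ?_
    rw [Finsupp.degree_eq_weight_one]
    exact hG (mem_support_iff.mp hu)
  · rw [map_sum]
    simp only [map_monomial, hlift]
    exact G.as_sum.symm

/-- The value of a form of degree `m` at elements of an ideal `I` lies in `I^m`. [folklore] -/
theorem eval_mem_pow_of_isHomogeneous {R : Type u} [CommRing R] {d m : ℕ} (x : Fin d → R) {I : Ideal R} (hx : ∀ i, x i ∈ I)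
    {F : MvPolynomial (Fin d) R} (hF : F.IsHomogeneous m) : eval x F ∈ I ^ m := by
  obtain ⟨c, rfl⟩ := exists_toForm_eq_of_isHomogeneous hF
  rw [← evalMonomials_eq_eval_toForm]
  exact evalMonomials_mem_pow x m hx c

variable (y : Fin d → A) (hy : Ideal.span (Set.range y) = maximalIdeal A) (j : Fin d)
  [IsLocalRing (A ⧸ Ideal.span {y j})] [IsLocalHom (algebraMap A (A ⧸ Ideal.span {y j}))]

omit [IsLocalHom (algebraMap A (A ⧸ Ideal.span {y j}))] in
/-- `𝔪_A · (A/tA) = 𝔪_{A/tA}`. [folklore] -/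
theorem map_maximalIdeal_algebraMap_quotient_eq :
    (maximalIdeal A).map (algebraMap A (A ⧸ Ideal.span {y j})) = maximalIdeal (A ⧸ Ideal.span {y j}) := by
  rw [Ideal.Quotient.algebraMap_eq]
  exact IsLocalRing.map_maximalIdeal_of_surjective _ Ideal.Quotient.mk_surjective

/-- **`gr_𝔪(A/tA) = gr_𝔪(A)/(T)` for a superficial non-zero-divisor symbol `T = in(t)`, `t = y_j`**: if `t·a ∈ 𝔪^{s+1} ⇒ a ∈ 𝔪^s` for all
`s`, then the ideal of initial forms of `A/tA` w.r.t. the images of the generators `y` is contained in (hence, with the tree's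
`map_tangentConeIdeal_le`, equal to) `J_A(y) · k'[X] + (X_j)`. [OURS · L1 W4.2; AI-written]
[cite: CossartJannsenSaito2020, §2.2 (p. 27)] [cite: HerrmannIkedaOrbanz1988, Thm. (22.24)] -/
theorem tangentConeIdeal_quotient_le_map_sup_span_X
    (hinj : ∀ (s : ℕ) (a : A), y j * a ∈ maximalIdeal A ^ (s + 1) → a ∈ maximalIdeal A ^ s) :
    tangentConeIdeal (fun i => algebraMap A (A ⧸ Ideal.span {y j}) (y i))
        (span_range_algebraMap_eq (map_maximalIdeal_algebraMap_quotient_eq y j) y hy) ≤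
      (tangentConeIdeal y hy).map (MvPolynomial.map (ResidueField.map (algebraMap A (A ⧸ Ideal.span {y j})))) ⊔
        Ideal.span {(X j : MvPolynomial (Fin d) (ResidueField (A ⧸ Ideal.span {y j})))} := by
  classical
  have hmk : Function.Surjective (algebraMap A (A ⧸ Ideal.span {y j})) := by
    rw [Ideal.Quotient.algebraMap_eq]; exact Ideal.Quotient.mk_surjective
  have hkmk : RingHom.ker (algebraMap A (A ⧸ Ideal.span {y j})) = Ideal.span {y j} := by
    rw [Ideal.Quotient.algebraMap_eq, Ideal.mk_ker]
  set B := A ⧸ Ideal.span {y j} with hB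
  set hyB := span_range_algebraMap_eq (map_maximalIdeal_algebraMap_quotient_eq y j) y hy with hhyB
  have hym : ∀ i, y i ∈ maximalIdeal A := fun i => hy ▸ Ideal.subset_span ⟨i, rfl⟩
  conv_lhs => rw [tangentConeIdeal]
  rw [Ideal.span_le]
  intro F hF
  obtain ⟨m, hFm⟩ := Set.mem_iUnion.mp hF
  rw [SetLike.mem_coe] at hFm ⊢
  obtain ⟨G, hG, hGev, rfl⟩ := (mem_symbolForms_iff_exists_form _ hyB).mp hFm
  -- lift `G` to `A`
  obtain ⟨G', hG', rfl⟩ := exists_isHomogeneous_map_eq_of_surjective (algebraMap A B) hmk G hG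
  -- `eval y G' ∈ 𝔪^{m+1} + (t)`
  have hev : algebraMap A B (eval y G') ∈ maximalIdeal B ^ (m + 1) := by
    have : eval (fun i => algebraMap A B (y i)) (MvPolynomial.map (algebraMap A B) G') = algebraMap A B (eval y G') := by
      rw [eval_map, show eval y G' = eval₂ (RingHom.id A) y G' from rfl, eval₂_comp_left, RingHom.comp_id]
      rfl
    rw [← this]; exact hGev
  have hev' : eval y G' ∈ maximalIdeal A ^ (m + 1) ⊔ Ideal.span {y j} := by
    rw [← map_maximalIdeal_algebraMap_quotient_eq y j, ← Ideal.map_pow, Ideal.mem_map_iff_of_surjective _ hmk] at hev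
    obtain ⟨u, hu, huv⟩ := hev
    have hdiff : eval y G' - u ∈ Ideal.span {y j} := by
      rw [← hkmk, RingHom.mem_ker, map_sub, huv, sub_self]
    have : eval y G' = u + (eval y G' - u) := by ring
    rw [this]
    exact Submodule.add_mem_sup hu hdiff
  obtain ⟨u, hu, w, hw, huw⟩ := Submodule.mem_sup.mp hev'
  obtain ⟨a, rfl⟩ := Ideal.mem_span_singleton'.mp hw
  -- the degree
  rcases Nat.eq_zero_or_pos m with rfl | hmpos
  · -- degree `0`: `G'` is a constant with value in `𝔪`, so its reduction vanishes
    have hGC : G' = C (coeff 0 G') := by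
      rcases eq_or_ne G' 0 with h0 | h0
      · rw [h0, coeff_zero, C_0]
      · exact totalDegree_eq_zero_iff_eq_C.mp (hG'.totalDegree h0)
    have hc0 : coeff 0 G' ∈ maximalIdeal A := by
      have h1 : eval y G' = coeff 0 G' := by rw [hGC, eval_C, coeff_C, if_pos rfl]
      rw [← h1]
      rw [zero_add, pow_one] at hev'
      have hle : maximalIdeal A ⊔ Ideal.span {y j} ≤ maximalIdeal A :=
        sup_le le_rfl (by rw [Ideal.span_singleton_le_iff_mem]; exact hym j)
      exact hle hev'
    have hzero : MvPolynomial.map (residue B) (MvPolynomial.map (algebraMap A B) G') = 0 := by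
      rw [hGC, map_C, map_C, C_eq_zero, residue_eq_zero_iff]
      have := Ideal.mem_map_of_mem (algebraMap A B) hc0
      rwa [map_maximalIdeal_algebraMap_quotient_eq y j] at this
    rw [hzero]; exact zero_mem _
  -- degree `m ≥ 1`: `t·a ∈ 𝔪^m`, so `a ∈ 𝔪^{m-1}` is the value of a form `H` of degree `m - 1`
  obtain ⟨m', rfl⟩ : ∃ m', m = m' + 1 := ⟨m - 1, (Nat.succ_pred_eq_of_pos hmpos).symm⟩
  have hta : y j * a ∈ maximalIdeal A ^ (m' + 1) := by
    have h1 : y j * a = eval y G' - u := by rw [huw.symm]; ring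
    rw [h1]
    exact sub_mem (eval_mem_pow_of_isHomogeneous y hym hG') (Ideal.pow_le_pow_right (Nat.le_succ _) hu)
  have ha : a ∈ Ideal.span (Set.range y) ^ m' := by rw [hy]; exact hinj m' a hta
  obtain ⟨H, hH, hHa⟩ := (Ideal.mem_span_pow_iff_exists_isHomogeneous y a).mp ha
  -- the corrected form `P = G' − X_j H` has `P(y) = u ∈ 𝔪^{m+1}`
  set P : MvPolynomial (Fin d) A := G' - X j * H with hPdef
  have hPh : P.IsHomogeneous (m' + 1) := by
    rw [hPdef]
    refine hG'.sub ?_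
    have := (isHomogeneous_X A j).mul hH
    rwa [add_comm] at this
  have hPev : eval y P ∈ maximalIdeal A ^ (m' + 1 + 1) := by
    have : eval y P = u := by
      rw [hPdef, map_sub, map_mul, eval_X, hHa, ← huw]; ring
    rw [this]; exact hu
  have hPmem : MvPolynomial.map (residue A) P ∈ tangentConeIdeal y hy :=
    mem_tangentConeIdeal_of_mem_symbolForms y hy (m' + 1) ((mem_symbolForms_iff_exists_form y hy).mpr ⟨P, hPh, hPev, rfl⟩)
  -- reduce to `B`
  have hred : MvPolynomial.map (residue B) (MvPolynomial.map (algebraMap A B) G') =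
      MvPolynomial.map (ResidueField.map (algebraMap A B)) (MvPolynomial.map (residue A) P) +
        X j * MvPolynomial.map (residue B) (MvPolynomial.map (algebraMap A B) H) := by
    have hcomp : (ResidueField.map (algebraMap A B)).comp (residue A) = (residue B).comp (algebraMap A B) :=
      RingHom.ext fun a => by simp
    rw [MvPolynomial.map_map, MvPolynomial.map_map, hcomp, ← MvPolynomial.map_map, ← MvPolynomial.map_map, hPdef]
    simp only [map_sub, map_mul, map_X]
    ring
  rw [hred]
  exact Submodule.add_mem_sup (Ideal.mem_map_of_mem _ hPmem) (Ideal.mul_mem_right _ _ (Ideal.mem_span_singleton_self _))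

end Quotient

end Summit.ResolutionOfSingularities.ResolutionOfSingularities.Theorems.SigmaMaxModificationsCorridor3.E1Free

end
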